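import Summits.Ventures.HSemireg.Mod4SiteMiddleModel

/-!
# Venture HSemireg — MOD-4 line: the coupled block `U` of THEOREM R_f's middle degree IN th-7's WEIL MODEL, part 2
# (independence of the tags; `dim span{μ_B ∧ v, μ′_{B′} ∧ v} + dim ker(M_f(q̃) − ab) = 2ⁿ + 2ⁿ`, every `n ≥ 1`, `ab ≠ 0`)

HONEST FRAMING. Part of the Lean index of the computation cell `pub-hsemireg` (widening group W3, seat w3-mod4-1 gen 5; files
of record `HOME/widen/W3/MOD4-OFFSPLIT-w3mod4.md` §10.2 / §11, `MOD4-THEOREM-RF-PROOF-w3mod4.md` v1.0 §4).  Finite-dimensional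
exterior algebra over a field ONLY (th-7's wedge model): no abelian variety, no sheaf, no Ext group, no semiregularity map; nothing
here says that HC, HC_CM or HC_AV holds; no Literature fact is declared or used; THEOREM R_f is NOT asserted here.  Sequel of
`Mod4SiteMiddleModel.lean` (rows `μ_B ∧ v`, `μ′_{B′} ∧ v` in the model).  WHAT IS PROVED: `tagSupport_injective` /
`linearIndependent_tags` — the tag family `g_B = μ_B·m_Q` (support `t_B ∪ Gm`), `f_{B′} = m_P·μ′_{B′}` (support `Dm ∪ t′_{B′}`) is
linearly independent (non-zero multiples of distinct basis monomials, `n ≥ 1`); and **`finrank_span_words_mul_vW`**: for `n ≥ 1`,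
`ab ≠ 0`, any `q`, `dim span{μ_B ∧ v, μ′_{B′} ∧ v : B, B′ ⊆ [n]} + dim ker(Mod4.middleM n q̃ − (ab)·1) = 2ⁿ + 2ⁿ` with
`q̃_i = (−1)^i q_i` — `Mod4SiteUBlock.finrank_span_Ublock` instantiated on th-7's `v = vW K (n+n) n q a b`: families (b)/(b′) of the
proof sheet §4 contribute exactly `2^{n+1} − dim ker(M_f − αβ)` to the middle degree, `αβ = (ar)(br) = ab`.
All statements and proofs: w3-mod4-1 g5 (2026-08-23).  Namespace `Summit.Ventures.HSemireg.Mod4Site`.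
-/

namespace Summit.Ventures.HSemireg.Mod4Site

open ExteriorAlgebra Summit.Ventures.HSemireg.Wedge Summit.Ventures.HSemireg.Wedge.Hankel Summit.Ventures.HSemireg.Wedge.Weil
open Summit.Ventures.HSemireg.Wedge.WeilPurity (r r_ne_zero)
open Summit.Ventures.HSemireg.Mod4

variable {K : Type*} [Field K] {n : ℕ}

/-! ### §4 The tags `g_B = μ_B·m_Q`, `f_{B′} = m_P·μ′_{B′}` are independent; the `U`-part of the middle degree -/

section UPart

/-- `y_k ∈ t_B ↔ k ∈ B` for the letter set `t_B` of `μ_B`. -/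
lemma yJ_mem_letterD (S : Finset (Fin n)) (k : Fin n) :
    yJ (n + n) (Fin.castAdd n k) ∈ (Finset.univ.image fun k : Fin n =>
      if k ∈ S then yJ (n + n) (Fin.castAdd n k) else xJ (n + n) (Fin.castAdd n k)) ↔ k ∈ S := by
  rw [Finset.mem_image]
  constructor
  · rintro ⟨k', -, hk'⟩
    by_cases h : k' ∈ S
    · rw [if_pos h, yJ_inj] at hk'
      have : k' = k := Fin.castAdd_injective _ _ hk'
      exact this ▸ h
    · rw [if_neg h] at hk'; exact absurd hk' (xJ_ne_yJ _ _)
  · intro h; exact ⟨k, Finset.mem_univ _, by rw [if_pos h]⟩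

/-- `x_k ∈ t_B ↔ k ∉ B`. -/
lemma xJ_mem_letterD (S : Finset (Fin n)) (k : Fin n) :
    xJ (n + n) (Fin.castAdd n k) ∈ (Finset.univ.image fun k : Fin n =>
      if k ∈ S then yJ (n + n) (Fin.castAdd n k) else xJ (n + n) (Fin.castAdd n k)) ↔ k ∉ S := by
  rw [Finset.mem_image]
  constructor
  · rintro ⟨k', -, hk'⟩
    by_cases h : k' ∈ S
    · rw [if_pos h] at hk'; exact absurd hk'.symm (xJ_ne_yJ _ _)
    · rw [if_neg h, xJ_inj] at hk'
      have : k' = k := Fin.castAdd_injective _ _ hk'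
      exact this ▸ h
  · intro h; exact ⟨k, Finset.mem_univ _, by rw [if_neg h]⟩

/-- `y′_k ∈ t′_{B′} ↔ k ∈ B′`. -/
lemma yJ_mem_letterG (S : Finset (Fin n)) (k : Fin n) :
    yJ (n + n) (Fin.natAdd n k) ∈ (Finset.univ.image fun k : Fin n =>
      if k ∈ S then yJ (n + n) (Fin.natAdd n k) else xJ (n + n) (Fin.natAdd n k)) ↔ k ∈ S := by
  rw [Finset.mem_image]
  constructor
  · rintro ⟨k', -, hk'⟩
    by_cases h : k' ∈ S
    · rw [if_pos h, yJ_inj] at hk'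
      have : k' = k := Fin.natAdd_injective _ _ hk'
      exact this ▸ h
    · rw [if_neg h] at hk'; exact absurd hk' (xJ_ne_yJ _ _)
  · intro h; exact ⟨k, Finset.mem_univ _, by rw [if_pos h]⟩

/-- `x′_k ∈ t′_{B′} ↔ k ∉ B′`. -/
lemma xJ_mem_letterG (S : Finset (Fin n)) (k : Fin n) :
    xJ (n + n) (Fin.natAdd n k) ∈ (Finset.univ.image fun k : Fin n =>
      if k ∈ S then yJ (n + n) (Fin.natAdd n k) else xJ (n + n) (Fin.natAdd n k)) ↔ k ∉ S := by
  rw [Finset.mem_image]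
  constructor
  · rintro ⟨k', -, hk'⟩
    by_cases h : k' ∈ S
    · rw [if_pos h] at hk'; exact absurd hk'.symm (xJ_ne_yJ _ _)
    · rw [if_neg h, xJ_inj] at hk'
      have : k' = k := Fin.natAdd_injective _ _ hk'
      exact this ▸ h
  · intro h; exact ⟨k, Finset.mem_univ _, by rw [if_neg h]⟩

/-- the `P`-letter `y_k` is not in `Gm`. -/
lemma yJ_castAdd_not_mem_Gm (k : Fin n) : yJ (n + n) (Fin.castAdd n k) ∉ Gm (n + n) n := by
  rw [mem_Gm_iff, pr_yJ, Fin.val_castAdd, not_le]; exact k.is_lt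
/-- the `Q`-letter `x′_k` is not in `Dm`. -/
lemma xJ_natAdd_not_mem_Dm (k : Fin n) : xJ (n + n) (Fin.natAdd n k) ∉ Dm (n + n) n := by
  rw [mem_Dm_iff, pr_xJ, Fin.val_natAdd, not_lt]; exact Nat.le_add_right n k
/-- the `Q`-letter `y′_k` is not in `Dm`. -/
lemma yJ_natAdd_not_mem_Dm (k : Fin n) : yJ (n + n) (Fin.natAdd n k) ∉ Dm (n + n) n := by
  rw [mem_Dm_iff, pr_yJ, Fin.val_natAdd, not_lt]; exact Nat.le_add_right n k
/-- the `Q`-letter `x′_k` is in `Gm`. -/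
lemma xJ_natAdd_mem_Gm (k : Fin n) : xJ (n + n) (Fin.natAdd n k) ∈ Gm (n + n) n := by
  rw [mem_Gm_iff, pr_xJ, Fin.val_natAdd]; exact Nat.le_add_right n k
/-- the `Q`-letter `y′_k` is in `Gm`. -/
lemma yJ_natAdd_mem_Gm (k : Fin n) : yJ (n + n) (Fin.natAdd n k) ∈ Gm (n + n) n := by
  rw [mem_Gm_iff, pr_yJ, Fin.val_natAdd]; exact Nat.le_add_right n k
/-- the `P`-letter `x_k` is in `Dm`. -/
lemma xJ_castAdd_mem_Dm (k : Fin n) : xJ (n + n) (Fin.castAdd n k) ∈ Dm (n + n) n := by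
  rw [mem_Dm_iff, pr_xJ, Fin.val_castAdd]; exact k.is_lt
/-- the `P`-letter `y_k` is in `Dm`. -/
lemma yJ_castAdd_mem_Dm (k : Fin n) : yJ (n + n) (Fin.castAdd n k) ∈ Dm (n + n) n := by
  rw [mem_Dm_iff, pr_yJ, Fin.val_castAdd]; exact k.is_lt

/-- the support map of the tags: `inl B ↦ t_B ∪ Gm`, `inr B′ ↦ Dm ∪ t′_{B′}` is injective (`n ≥ 1`). -/
lemma tagSupport_injective (hn : 1 ≤ n) :
    Function.Injective (Sum.elim
      (fun S : Finset (Fin n) => (Finset.univ.image fun k : Fin n =>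
        if k ∈ S then yJ (n + n) (Fin.castAdd n k) else xJ (n + n) (Fin.castAdd n k)) ∪ Gm (n + n) n)
      (fun S' : Finset (Fin n) => Dm (n + n) n ∪ (Finset.univ.image fun k : Fin n =>
        if k ∈ S' then yJ (n + n) (Fin.natAdd n k) else xJ (n + n) (Fin.natAdd n k)))) := by
  rintro (S₁ | S₁) (S₂ | S₂) h <;> simp only [Sum.elim_inl, Sum.elim_inr] at h
  · congr 1; ext k
    have e := congrArg (fun T => yJ (n + n) (Fin.castAdd n k) ∈ T) h
    simp only [Finset.mem_union, yJ_mem_letterD, or_iff_left (yJ_castAdd_not_mem_Gm k), eq_iff_iff] at e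
    exact e
  · exfalso
    have hx : xJ (n + n) (Fin.natAdd n ⟨0, hn⟩) ∈ Dm (n + n) n ∪ _ := h ▸ Finset.mem_union_right _ (xJ_natAdd_mem_Gm _)
    have hy : yJ (n + n) (Fin.natAdd n ⟨0, hn⟩) ∈ Dm (n + n) n ∪ _ := h ▸ Finset.mem_union_right _ (yJ_natAdd_mem_Gm _)
    rw [Finset.mem_union, or_iff_right (xJ_natAdd_not_mem_Dm _), xJ_mem_letterG] at hx
    rw [Finset.mem_union, or_iff_right (yJ_natAdd_not_mem_Dm _), yJ_mem_letterG] at hy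
    exact hx hy
  · exfalso
    have hx : xJ (n + n) (Fin.natAdd n ⟨0, hn⟩) ∈ Dm (n + n) n ∪ _ := h.symm ▸ Finset.mem_union_right _ (xJ_natAdd_mem_Gm _)
    have hy : yJ (n + n) (Fin.natAdd n ⟨0, hn⟩) ∈ Dm (n + n) n ∪ _ := h.symm ▸ Finset.mem_union_right _ (yJ_natAdd_mem_Gm _)
    rw [Finset.mem_union, or_iff_right (xJ_natAdd_not_mem_Dm _), xJ_mem_letterG] at hx
    rw [Finset.mem_union, or_iff_right (yJ_natAdd_not_mem_Dm _), yJ_mem_letterG] at hy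
    exact hx hy
  · congr 1; ext k
    have e := congrArg (fun T => yJ (n + n) (Fin.natAdd n k) ∈ T) h
    simp only [Finset.mem_union, yJ_mem_letterG, or_iff_right (yJ_natAdd_not_mem_Dm k), eq_iff_iff] at e
    exact e

/-- **the tags `g ⊔ f` are linearly independent** (non-zero multiples of distinct basis monomials), `n ≥ 1`. -/
theorem linearIndependent_tags (hn : 1 ≤ n) :
    LinearIndependent K (Sum.elim
      (fun S : Finset (Fin n) => (List.ofFn fun k : Fin n => ι K (if k ∈ S then b K (In (n + n)) (yJ (n + n) (Fin.castAdd n k))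
          else b K (In (n + n)) (xJ (n + n) (Fin.castAdd n k)))).prod *
        (List.ofFn fun k : Fin n => ι K (b K (In (n + n)) (xJ (n + n) (Fin.natAdd n k))) *
          ι K (b K (In (n + n)) (yJ (n + n) (Fin.natAdd n k)))).prod)
      (fun S' : Finset (Fin n) => (List.ofFn fun k : Fin n => ι K (b K (In (n + n)) (xJ (n + n) (Fin.castAdd n k))) *
          ι K (b K (In (n + n)) (yJ (n + n) (Fin.castAdd n k)))).prod *
        (List.ofFn fun k : Fin n => ι K (if k ∈ S' then b K (In (n + n)) (yJ (n + n) (Fin.natAdd n k))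
          else b K (In (n + n)) (xJ (n + n) (Fin.natAdd n k)))).prod)) := by
  classical
  -- m_Q = r⁻¹ E_{Gm}, m_P = r⁻¹ E_{Dm}
  have hmQ : (List.ofFn fun k : Fin n => ι K (b K (In (n + n)) (xJ (n + n) (Fin.natAdd n k))) *
      ι K (b K (In (n + n)) (yJ (n + n) (Fin.natAdd n k)))).prod = (r K n)⁻¹ • B K (In (n + n)) (Gm (n + n) n) := by
    rw [eq_inv_smul_iff₀ (r_ne_zero K (n := n)), B_Gm_eq_smul_pairProd]
  have hmP : (List.ofFn fun k : Fin n => ι K (b K (In (n + n)) (xJ (n + n) (Fin.castAdd n k))) *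
      ι K (b K (In (n + n)) (yJ (n + n) (Fin.castAdd n k)))).prod = (r K n)⁻¹ • B K (In (n + n)) (Dm (n + n) n) := by
    rw [eq_inv_smul_iff₀ (r_ne_zero K (n := n)), B_Dm_eq_smul_pairProd]
  -- choose the unit of each selection word
  choose cD hcD hcD' using fun S : Finset (Fin n) => wordP_eq_smul_B (K := K) S
  choose cG hcG hcG' using fun S : Finset (Fin n) => wordQ_eq_smul_B (K := K) S
  -- the coefficient of each tag on its support monomial
  set σ := Sum.elim
      (fun S : Finset (Fin n) => (Finset.univ.image fun k : Fin n =>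
        if k ∈ S then yJ (n + n) (Fin.castAdd n k) else xJ (n + n) (Fin.castAdd n k)) ∪ Gm (n + n) n)
      (fun S' : Finset (Fin n) => Dm (n + n) n ∪ (Finset.univ.image fun k : Fin n =>
        if k ∈ S' then yJ (n + n) (Fin.natAdd n k) else xJ (n + n) (Fin.natAdd n k))) with hσ
  set w : Finset (Fin n) ⊕ Finset (Fin n) → K := Sum.elim
      (fun S => cD S * (r K n)⁻¹ * u K (Finset.univ.image fun k : Fin n =>
        if k ∈ S then yJ (n + n) (Fin.castAdd n k) else xJ (n + n) (Fin.castAdd n k)) (Gm (n + n) n))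
      (fun S' => (r K n)⁻¹ * cG S' * u K (Dm (n + n) n) (Finset.univ.image fun k : Fin n =>
        if k ∈ S' then yJ (n + n) (Fin.natAdd n k) else xJ (n + n) (Fin.natAdd n k))) with hw
  have hw0 : ∀ i, w i ≠ 0 := by
    rintro (S | S)
    · simp only [hw, Sum.elim_inl]
      exact mul_ne_zero (mul_ne_zero (hcD S) (inv_ne_zero (r_ne_zero K (n := n))))
        ((u_ne_zero_iff K).mpr ((disjoint_Dm_Gm n).mono_left (letterD_subset_Dm S)))
    · simp only [hw, Sum.elim_inr]
      exact mul_ne_zero (mul_ne_zero (inv_ne_zero (r_ne_zero K (n := n))) (hcG S))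
        ((u_ne_zero_iff K).mpr ((disjoint_Dm_Gm n).mono_right (letterG_subset_Gm S)))
  have hB : LinearIndependent K (fun i => B K (In (n + n)) (σ i)) :=
    (B K (In (n + n))).linearIndependent.comp σ (tagSupport_injective hn)
  have key := hB.units_smul (fun i => Units.mk0 (w i) (hw0 i))
  convert key using 1
  funext i
  rcases i with S | S
  · simp only [Sum.elim_inl, Pi.smul_apply', Units.smul_mk0, hσ, hw]
    rw [hcD', hmQ, smul_mul_smul_comm, B_mul_B, smul_smul]
  · simp only [Sum.elim_inr, Pi.smul_apply', Units.smul_mk0, hσ, hw]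
    rw [hcG', hmP, smul_mul_smul_comm, B_mul_B, smul_smul]

/-- `r² = 1`. -/
lemma r_mul_r : r K n * r K n = 1 := by
  rw [r, ← pow_add, ← two_mul, pow_mul, neg_one_sq, one_pow]

/-- **THE `U`-PART OF THE MIDDLE DEGREE IN THE MODEL** (families (b)/(b′) of the proof sheet §4): for `n ≥ 1`, `ab ≠ 0`,
`dim span{μ_B ∧ v, μ′_{B′} ∧ v : B, B′ ⊆ [n]} + dim ker(M_f(q̃) − ab) = 2ⁿ + 2ⁿ`, `q̃_i = (−1)^i q_i`, `M_f = Mod4.middleM`. -/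
theorem finrank_span_words_mul_vW (hn : 1 ≤ n) (q : ℕ → K) {a b' : K} (ha : a ≠ 0) (hb : b' ≠ 0) :
    Module.finrank K (Submodule.span K (Set.range (Sum.elim
      (fun S : Finset (Fin n) => (List.ofFn fun k : Fin n => ι K (if k ∈ S then b K (In (n + n)) (yJ (n + n) (Fin.castAdd n k))
          else b K (In (n + n)) (xJ (n + n) (Fin.castAdd n k)))).prod * vW K (n + n) n q a b')
      (fun S' : Finset (Fin n) => (List.ofFn fun k : Fin n => ι K (if k ∈ S' then b K (In (n + n)) (yJ (n + n) (Fin.natAdd n k))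
          else b K (In (n + n)) (xJ (n + n) (Fin.natAdd n k)))).prod * vW K (n + n) n q a b')))) +
      Module.finrank K (LinearMap.ker (Matrix.toLin' (middleM n (fun i => (-1 : K) ^ i * q i)) - (a * b') • LinearMap.id)) =
      2 ^ n + 2 ^ n := by
  have h := finrank_span_Ublock (K := K) (n := n)
    (fun S : Finset (Fin n) => (List.ofFn fun k : Fin n => ι K (if k ∈ S then b K (In (n + n)) (yJ (n + n) (Fin.castAdd n k))
        else b K (In (n + n)) (xJ (n + n) (Fin.castAdd n k)))).prod *
      (List.ofFn fun k : Fin n => ι K (b K (In (n + n)) (xJ (n + n) (Fin.natAdd n k))) *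
        ι K (b K (In (n + n)) (yJ (n + n) (Fin.natAdd n k)))).prod)
    (fun S' : Finset (Fin n) => (List.ofFn fun k : Fin n => ι K (b K (In (n + n)) (xJ (n + n) (Fin.castAdd n k))) *
        ι K (b K (In (n + n)) (yJ (n + n) (Fin.castAdd n k)))).prod *
      (List.ofFn fun k : Fin n => ι K (if k ∈ S' then b K (In (n + n)) (yJ (n + n) (Fin.natAdd n k))
        else b K (In (n + n)) (xJ (n + n) (Fin.natAdd n k)))).prod)
    (linearIndependent_tags hn) (fun i => (-1 : K) ^ i * q i) (α := a * r K n) (β := b' * r K n)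
    (mul_ne_zero ha (r_ne_zero K (n := n))) (mul_ne_zero hb (r_ne_zero K (n := n)))
  have hab : a * r K n * (b' * r K n) = a * b' := by
    rw [mul_mul_mul_comm, r_mul_r, mul_one]
  rw [hab] at h
  have hrows : Sum.elim
      (fun S : Finset (Fin n) => (List.ofFn fun k : Fin n => ι K (if k ∈ S then b K (In (n + n)) (yJ (n + n) (Fin.castAdd n k))
          else b K (In (n + n)) (xJ (n + n) (Fin.castAdd n k)))).prod * vW K (n + n) n q a b')
      (fun S' : Finset (Fin n) => (List.ofFn fun k : Fin n => ι K (if k ∈ S' then b K (In (n + n)) (yJ (n + n) (Fin.natAdd n k))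
          else b K (In (n + n)) (xJ (n + n) (Fin.natAdd n k)))).prod * vW K (n + n) n q a b') =
    Sum.elim
      (fun S : Finset (Fin n) => (a * r K n) • ((List.ofFn fun k : Fin n => ι K (if k ∈ S then b K (In (n + n)) (yJ (n + n) (Fin.castAdd n k))
          else b K (In (n + n)) (xJ (n + n) (Fin.castAdd n k)))).prod *
        (List.ofFn fun k : Fin n => ι K (b K (In (n + n)) (xJ (n + n) (Fin.natAdd n k))) *
          ι K (b K (In (n + n)) (yJ (n + n) (Fin.natAdd n k)))).prod) +
        ∑ S' : Finset (Fin n), (((-1 : K) ^ (n + 1).choose 2) * (-1 : K) ^ S'.card *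
          ((-1 : K) ^ (n - S.card + S'.card) * q (n - S.card + S'.card))) •
        ((List.ofFn fun k : Fin n => ι K (b K (In (n + n)) (xJ (n + n) (Fin.castAdd n k))) *
            ι K (b K (In (n + n)) (yJ (n + n) (Fin.castAdd n k)))).prod *
         (List.ofFn fun k : Fin n => ι K (if k ∈ S' then b K (In (n + n)) (yJ (n + n) (Fin.natAdd n k))
            else b K (In (n + n)) (xJ (n + n) (Fin.natAdd n k)))).prod))
      (fun S' : Finset (Fin n) => (∑ S : Finset (Fin n), ((-1 : K) ^ n * ((-1 : K) ^ (n + 1).choose 2) * (-1 : K) ^ S.card *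
          ((-1 : K) ^ (n - S'.card + S.card) * q (n - S'.card + S.card))) •
        ((List.ofFn fun k : Fin n => ι K (if k ∈ S then b K (In (n + n)) (yJ (n + n) (Fin.castAdd n k))
            else b K (In (n + n)) (xJ (n + n) (Fin.castAdd n k)))).prod *
         (List.ofFn fun k : Fin n => ι K (b K (In (n + n)) (xJ (n + n) (Fin.natAdd n k))) *
            ι K (b K (In (n + n)) (yJ (n + n) (Fin.natAdd n k)))).prod)) +
      (b' * r K n) • ((List.ofFn fun k : Fin n => ι K (b K (In (n + n)) (xJ (n + n) (Fin.castAdd n k))) *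
            ι K (b K (In (n + n)) (yJ (n + n) (Fin.castAdd n k)))).prod *
        (List.ofFn fun k : Fin n => ι K (if k ∈ S' then b K (In (n + n)) (yJ (n + n) (Fin.natAdd n k))
            else b K (In (n + n)) (xJ (n + n) (Fin.natAdd n k)))).prod)) := by
    funext i
    rcases i with S | S'
    · simp only [Sum.elim_inl]; exact wordP_mul_vW hn S q a b'
    · simp only [Sum.elim_inr]; exact wordQ_mul_vW hn S' q a b'
  rw [hrows]
  exact h

end UPart

end Summit.Ventures.HSemireg.Mod4Site
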